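import Summits.AtomisticToContinuum.HydrodynamicLimit.Theorems.InformationPercolationEnginePercolationClosesChaosDocking
import Summits.AtomisticToContinuum.HydrodynamicLimit.Theorems.InformationPercolationEnginePercolationClosesChaosForecastRetyped
import HarnessLib

/-!
# Docking S7 of the line `equilibrium-forecast-chain-rule` (crux `InformationPercolationEngine.PercolationClosesChaos`,
stmt-AtomisticToContinuum-15178) — skeleton v5: the docking from the `r`-ball residual alone

Support file (`--supports stmt-AtomisticToContinuum-15178`): the registered stub S7 of skeleton v5,
`stub_dockingR : KineticCellChaosLG → NoMesoscopicOscillationR → LocalCountUI → ContactChaos`. Skeleton v4's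
`stub_docking` (`…Docking.lean`, p136041) consumed the v2 statement `NoMesoscopicOscillation = (i) ∧ (ii)` but its assembly
`docking_of_aemeasurable` (`…DockingAssembly.lean`, p135282) used conjunct (i) only; conjunct (ii) turned out vacuous as typed
(worker S5 audit of cycle 4) and was re-typed as `NoKineticIrregularity`, conjunct (i) became the stand-alone
`NoMesoscopicOscillationR` (`…ForecastRetyped.lean`). This file repeats the assembly with the weakened hypothesis
(`docking_of_aemeasurable_R`, the proof text of piece G with `NoMesoscopicOscillation` (i) read directly) and composes it with
worker S7-M's a.e.-measurability facts `aemeasurable_unitAvg_badWeight`, `aemeasurable_unitAvg_rowCount_trunc`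
(`…DockingMeasurable.lean`, p135792). Pieces A–F2, M as listed in `…Docking.lean`.

Bookkeeping (Markov, union bound); CIP 1994 §4.2, Spohn 1991 Part I Ch. 3 for the objects.
-/

noncomputable section

open MeasureTheory Set Filter Topology
open scoped ENNReal BigOperators Classical
open Literature.Analysis.FluidPDE Literature.MathematicalPhysics.KineticTheory
open Literature.MathematicalPhysics.KineticTheory.VelocityBlindPlacement

namespace Summit.AtomisticToContinuum.HydrodynamicLimit.Theorems.EquilibriumForecastLine

/-! ## The assembly, from `NoMesoscopicOscillationR` -/

set_option maxHeartbeats 400000 in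
/-- **`docking_of_aemeasurable_R` (piece G of the docking S7, skeleton v5): the kinetic docking from the `r`-ball residual
`NoMesoscopicOscillationR` alone, given the two a.e.-measurability facts.** Verbatim the assembly `docking_of_aemeasurable` of
`…DockingAssembly.lean` (which consumed the v2 statement `NoMesoscopicOscillation` but used only its conjunct (i)), with the
hypothesis weakened to that conjunct: constants in the quantifier order of the target, Markov (`measure_lt_le_of_lintegral_le`,
`measure_energy_gt_le`), the deterministic bound `abs_dockDefect_le` on the complement of the five bad events, the union bound, and
`measure_contactDefect_le`. [folklore] -/
theorem docking_of_aemeasurable_R : (∀ {σ : ℝ} {N : ℕ} (Φ : Flow σ N), 0 < σ → σ < 2⁻¹ → ∀ (Ψ : V3 × V3 × V3 → ℝ), Continuous Ψ → ∀ (η T c τ : ℝ), 0 ≤ T → 0 < c → AEMeasurable (fun z : Phase N => unitAvg c σ N τ (fun k q => badWeight Ψ η T c σ N Φ k q z)) (liouville G3 (N + 1) (hsDiameter σ N))) → (∀ {σ : ℝ} {N : ℕ} (Φ : Flow σ N), 0 < σ → σ < 2⁻¹ → ∀ (T c τ : ℝ), 0 < c → AEMeasurable (fun z : Phase N => unitAvg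 c σ N τ (fun k q => rowCount c σ N Φ k q z * (if T < rowCount c σ N Φ k q z then 1 else 0))) (liouville G3 (N + 1) (hsDiameter σ N))) → KineticCellChaosLG → NoMesoscopicOscillationR → LocalCountUI → Summit.AtomisticToContinuum.HydrodynamicLimit.Theses.InformationPercolationEngine.ContactChaos := by
  intro hMB hMU hKCC hNMO hUI a₀ θ₀ u₀ ha hθ hu ha0 hθ0
  obtain ⟨σK, hσK, HK⟩ := hKCC a₀ θ₀ u₀ ha hθ hu ha0 hθ0
  obtain ⟨σN, hσN, HN⟩ := hNMO a₀ θ₀ u₀ ha hθ hu ha0 hθ0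
  obtain ⟨σU, hσU, HU⟩ := hUI 1 one_pos a₀ θ₀ u₀ ha hθ hu ha0 hθ0
  refine ⟨min (min σK σN) (min σU 2⁻¹), lt_min (lt_min hσK hσN) (lt_min hσU (by norm_num)), ?_⟩
  intro σ hσ hσ0 Φ τ hτ χ hχc Ψ hΨc hΨb η δ hη hδ
  obtain ⟨CΨ, hΨ⟩ := hΨb
  have hσK' : σ < σK := hσ0.trans_le ((min_le_left _ _).trans (min_le_left _ _))
  have hσN' : σ < σN := hσ0.trans_le ((min_le_left _ _).trans (min_le_right _ _))
  have hσU' : σ < σU := hσ0.trans_le ((min_le_right _ _).trans (min_le_left _ _))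
  have hσ2 : σ < 2⁻¹ := hσ0.trans_le ((min_le_right _ _).trans (min_le_right _ _))
  have hσhalf : σ ≤ 1 / 2 := by rw [one_div]; exact hσ2.le
  have hCΨ0 : 0 ≤ CΨ := (abs_nonneg _).trans (hΨ 0)
  -- `P`, `S`, `Cχ`
  set P := Real.pi * σ ^ 3 with hP
  have hP0 : 0 < P := by positivity
  set S := τ + 1 with hS
  obtain ⟨Cχ, hCχ0, hχ⟩ := exists_bound_localiser hχc S
  -- the energy constant
  obtain ⟨A, bA, hA, -, Hdom⟩ :=
    LambertianContactSwapSwapGapGibbsDomination.exists_localGibbsLaw_dominated ha hθ hu ha0 hθ0 hσhalf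
  set E₀ := 4 * A / δ + 1 with hE₀
  have hE₀0 : 0 < E₀ := by positivity
  have hAE : A / E₀ ≤ δ / 4 := by
    rw [div_le_div_iff₀ hE₀0 four_pos, hE₀]
    have : δ * (4 * A / δ + 1) = 4 * A + δ := by field_simp
    nlinarith
  -- the tolerance `ηN` of the budget, before `r₀`
  obtain ⟨ηN, hηN, Hbud⟩ := docking_budget' P Cχ τ η hP0 hCχ0 hτ hη
  -- `NoMesoscopicOscillationR`: the mollification radius
  obtain ⟨r₀, hr₀, HN1⟩ := HN σ hσ hσN' Φ τ hτ Ψ hΨc ⟨CΨ, hΨ⟩ ηN (δ / 4) hηN (by positivity)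
  refine ⟨r₀, hr₀, fun r hr hrr₀ => ?_⟩
  -- the `r`-level constants of the two mollified pair fields
  set M3 := sphereMeasure.real (univ : Set (Metric.sphere (0 : V3) 1)) with hM3
  have hM30 : 0 ≤ M3 := measureReal_nonneg
  set P₁ := (3 / (Real.pi * r ^ 3)) ^ 2 * (M3 * 1) * (1 + 2 * E₀) with hP₁
  set PΨ := (3 / (Real.pi * r ^ 3)) ^ 2 * (M3 * CΨ) * (1 + 2 * E₀) with hPΨ
  set L₁ := 2 * (3 / (Real.pi * r ^ 4)) * (3 / (Real.pi * r ^ 3)) * (M3 * 1 * (1 + 2 * E₀)) with hL₁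
  set LΨ := 2 * (3 / (Real.pi * r ^ 4)) * (3 / (Real.pi * r ^ 3)) * (M3 * CΨ * (1 + 2 * E₀)) with hLΨ
  set S₁ := τ * (r⁻¹ * P₁) with hS₁
  set SΨ := τ * (r⁻¹ * PΨ) with hSΨ
  set Kt₁ := τ * (r⁻¹ * r⁻¹ * P₁) with hKt₁
  set Kx₁ := τ * (r⁻¹ * L₁) with hKx₁
  set KtΨ := τ * (r⁻¹ * r⁻¹ * PΨ) with hKtΨ
  set KxΨ := τ * (r⁻¹ * LΨ) with hKxΨ
  have hS₁0 : 0 ≤ S₁ := by positivity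
  have hSΨ0 : 0 ≤ SΨ := by positivity
  have hKt₁0 : 0 ≤ Kt₁ := by positivity
  have hKx₁0 : 0 ≤ Kx₁ := by positivity
  have hKtΨ0 : 0 ≤ KtΨ := by positivity
  have hKxΨ0 : 0 ≤ KxΨ := by positivity
  obtain ⟨b₂, hb₂, -, Hb⟩ := Hbud CΨ S₁ SΨ Kt₁ Kx₁ KtΨ KxΨ hCΨ0 hS₁0 hSΨ0 hKt₁0 hKx₁0 hKtΨ0 hKxΨ0
  -- `LocalCountUI` (i) at horizon `2τ`: the level `T₂`
  obtain ⟨T₂, hT₂, HU1⟩ := (HU σ hσ hσU' Φ (2 * τ) (by positivity) (b₂ * (δ / 4)) (by positivity)).1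
  obtain ⟨η₁, hη₁, ρ, hρ, b₁, hb₁, Hθ⟩ := Hb T₂ hT₂.le
  -- the modulus of the localiser
  obtain ⟨ϖ, hϖ, hχuc⟩ := exists_modulus_localiser hχc S hρ
  -- the kinetic scale `c`
  obtain ⟨c₀K, hc₀K, HK1⟩ := HK σ hσ hσK' Φ τ hτ Ψ hΨc ⟨CΨ, hΨ⟩ η₁ (b₁ * (δ / 4)) (2 * T₂) hη₁ (by positivity)
    (by positivity)
  obtain ⟨c₀N, hc₀N, HN2⟩ := HN1 r hr hrr₀
  set c := max (max c₀K c₀N) 1 with hcdef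
  have hc1 : (1 : ℝ) ≤ c := le_max_right _ _
  have hc : 0 < c := one_pos.trans_le hc1
  obtain ⟨N₀K, HK2⟩ := HK1 c ((le_max_left _ _).trans (le_max_left _ _))
  obtain ⟨N₀N, HN3⟩ := HN2 c ((le_max_right _ _).trans (le_max_left _ _))
  obtain ⟨N₀U, HU2⟩ := HU1 c hc1
  -- the energy / cell-count constant `Q` and the step threshold `θ`
  set Q := Real.sqrt (2 * T₂ * E₀ * (c ^ 3 / (Real.pi ^ 3 * σ ^ 6))) with hQ
  obtain ⟨θs, hθs, Hfin⟩ := Hθ ϖ hϖ Q (Real.sqrt_nonneg _)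
  obtain ⟨N₁, HN₁⟩ := eventually_stepLen_le (c := c) hσ (θ := min θs (min (ϖ / 3) (min τ 1))) (by positivity)
  refine ⟨max (max N₀K N₀N) (max N₀U N₁), fun N hN => ?_⟩
  have hNK : N₀K ≤ N := ((le_max_left _ _).trans (le_max_left _ _)).trans hN
  have hNN : N₀N ≤ N := ((le_max_right _ _).trans (le_max_left _ _)).trans hN
  have hNU : N₀U ≤ N := ((le_max_left _ _).trans (le_max_right _ _)).trans hN
  have hN1 : N₁ ≤ N := ((le_max_right _ _).trans (le_max_right _ _)).trans hN
  -- the step length at this `N`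
  set Δ := stepLen c σ N with hΔdef
  have hΔ : 0 < Δ := stepLen_pos hc hσ N
  have hΔle := HN₁ N hN1
  have hΔθ : Δ ≤ θs := hΔle.trans (min_le_left _ _)
  have hΔϖ : Δ < ϖ / 2 := (hΔle.trans ((min_le_right _ _).trans (min_le_left _ _))).trans_lt (by linarith)
  have hΔτ : Δ ≤ τ := hΔle.trans ((min_le_right _ _).trans ((min_le_right _ _).trans (min_le_left _ _)))
  have hΔ1 : Δ ≤ 1 := hΔle.trans ((min_le_right _ _).trans ((min_le_right _ _).trans (min_le_right _ _)))
  have hbound := Hfin Δ hΔ hΔθ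
  set μ := localGibbsLaw σ a₀ u₀ θ₀ N (Φ N) with hμ
  haveI : IsProbabilityMeasure μ := isProbabilityMeasure_localGibbsLaw ha hθ hu ha0 hθ0 hσhalf N (Φ N)
  -- the five bad events
  set BadN := {z : Phase N | ηN < unitAvg c σ N τ fun k q => ∑' q' : Cell,
    collPair (fun _ => 1) c σ N (Φ N) k q q' z *
      |targetPm (fun _ => 1) r τ σ N (Φ N) z ((k : ℝ) * stepLen c σ N) (cellCentre c σ N q) *
          (pairPair Ψ c σ N (Φ N) k q q' z / pairPair (fun _ => 1) c σ N (Φ N) k q q' z) -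
        targetPm Ψ r τ σ N (Φ N) z ((k : ℝ) * stepLen c σ N) (cellCentre c σ N q)|} with hBadN
  set BadK := {z : Phase N | b₁ < unitAvg c σ N τ (fun k q => badWeight Ψ η₁ (2 * T₂) c σ N (Φ N) k q z)} with hBadK
  set BadU := {z : Phase N | b₂ < unitAvg c σ N (2 * τ)
    (fun k q => rowCount c σ N (Φ N) k q z * (if T₂ < rowCount c σ N (Φ N) k q z then 1 else 0))} with hBadU
  set BadE := {z : Phase N | E₀ * ((N : ℝ) + 1) < configEnergy z} with hBadE
  set C0 := {z : Phase N | ∃ i j : Fin (N + 1), i ≠ j ∧ z ∈ contactSet G3 (N + 1) (hsDiameter σ N) i j} with hC0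
  have mN : μ BadN ≤ ENNReal.ofReal (δ / 4) := HN3 N hNN
  have mK : μ BadK ≤ ENNReal.ofReal (δ / 4) :=
    measure_lt_le_of_lintegral_le (Φ N) (hMB (Φ N) hσ hσ2 Ψ hΨc η₁ (2 * T₂) c τ (by positivity) hc) hb₁ (HK2 N hNK)
  have mU : μ BadU ≤ ENNReal.ofReal (δ / 4) :=
    measure_lt_le_of_lintegral_le (Φ N) (hMU (Φ N) hσ hσ2 T₂ c (2 * τ) hc) hb₂ (HU2 N hNU)
  have mE : μ BadE ≤ ENNReal.ofReal (δ / 4) := by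
    obtain ⟨-, -, -, hint, hmean⟩ := Hdom N (Φ N)
    exact (measure_energy_gt_le (Φ N) hE₀0 hint hmean).trans (ENNReal.ofReal_le_ofReal hAE)
  have m0 : μ C0 = 0 := CollisionRate.localGibbsLaw_setOf_exists_mem_contactSet hσ (Φ N)
  -- off the bad events the deterministic bound applies
  have hsub : {z | z ∈ (Φ N).good ∧ η < |dockDefect χ Ψ r τ σ N (Φ N) z|} ⊆ BadN ∪ BadK ∪ BadU ∪ BadE ∪ C0 := by
    rintro z ⟨hz, hzη⟩
    by_contra hnot
    have hnN : z ∉ BadN := fun h => hnot (mem_union_left _ (mem_union_left _ (mem_union_left _ (mem_union_left _ h))))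
    have hnK : z ∉ BadK := fun h => hnot (mem_union_left _ (mem_union_left _ (mem_union_left _ (mem_union_right _ h))))
    have hnU : z ∉ BadU := fun h => hnot (mem_union_left _ (mem_union_left _ (mem_union_right _ h)))
    have hnE : z ∉ BadE := fun h => hnot (mem_union_left _ (mem_union_right _ h))
    have hn0 : z ∉ C0 := fun h => hnot (mem_union_right _ h)
    rw [hBadN, Set.mem_setOf_eq, not_lt] at hnN
    rw [hBadK, Set.mem_setOf_eq, not_lt] at hnK
    rw [hBadU, Set.mem_setOf_eq, not_lt] at hnU
    rw [hBadE, Set.mem_setOf_eq, not_lt] at hnE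
    rw [hC0, Set.mem_setOf_eq] at hn0
    -- energy per particle of the datum
    have hNpos : (0 : ℝ) < ((N + 1 : ℕ) : ℝ) := by positivity
    have hE : ((N + 1 : ℕ) : ℝ)⁻¹ * configEnergy z ≤ E₀ := by
      rw [inv_mul_le_iff₀ hNpos]
      push_cast
      linarith
    -- the mollified pair fields of the orbit
    have h1b : ∀ p : V3 × V3 × V3, |(fun _ : V3 × V3 × V3 => (1 : ℝ)) p| ≤ 1 := fun _ => by simp
    have hS1 : ∀ s x, |targetPm (fun _ => 1) r τ σ N (Φ N) z s x| ≤ S₁ := fun s x => by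
      rw [hS₁, hP₁, targetPm_eq_poolPairField]
      exact abs_poolPairField_le hz h1b hr hτ.le hE (s, x)
    have hSΨ' : ∀ s x, |targetPm Ψ r τ σ N (Φ N) z s x| ≤ SΨ := fun s x => by
      rw [hSΨ, hPΨ, targetPm_eq_poolPairField]
      exact abs_poolPairField_le hz hΨ hr hτ.le hE (s, x)
    have hL1 : ∀ s x s' x', |targetPm (fun _ => 1) r τ σ N (Φ N) z s x - targetPm (fun _ => 1) r τ σ N (Φ N) z s' x'| ≤
        Kt₁ * |s - s'| + Kx₁ * Torus.euclidDist x x' := fun s x s' x' => by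
      rw [hKt₁, hKx₁, hP₁, hL₁, targetPm_eq_poolPairField, targetPm_eq_poolPairField]
      have h := abs_poolPairField_sub_le hz continuous_const h1b hr hτ.le hE (s, x) (s', x')
      dsimp only at h
      refine h.trans (le_of_eq ?_)
      ring
    have hLΨ : ∀ s x s' x', |targetPm Ψ r τ σ N (Φ N) z s x - targetPm Ψ r τ σ N (Φ N) z s' x'| ≤
        KtΨ * |s - s'| + KxΨ * Torus.euclidDist x x' := fun s x s' x' => by
      rw [hKtΨ, hKxΨ, hPΨ, hLΨ, targetPm_eq_poolPairField, targetPm_eq_poolPairField]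
      have h := abs_poolPairField_sub_le hz hΨc hΨ hr hτ.le hE (s, x) (s', x')
      dsimp only at h
      refine h.trans (le_of_eq ?_)
      ring
    -- the energy / cell-count constant
    have hQz : 2 * T₂ * (c * meanFreePath σ N) ^ 3 * configEnergy z ≤ Q ^ 2 := by
      rw [hQ, Real.sq_sqrt (by positivity), ← cellCount_eq c hσ N]
      unfold cellCount
      calc 2 * T₂ * (c * meanFreePath σ N) ^ 3 * configEnergy z
          ≤ 2 * T₂ * (c * meanFreePath σ N) ^ 3 * (E₀ * ((N : ℝ) + 1)) := mul_le_mul_of_nonneg_left hnE (by positivity)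
        _ = 2 * T₂ * E₀ * (((N : ℝ) + 1) * (c * meanFreePath σ N) ^ 3) := by ring
    have hF2 := abs_dockDefect_le (Φ N) hz hn0 hc hσ hσ2 χ hΨc r hτ hΔτ hΔ1 (S := S) (by rw [hS]; linarith) hχ hχuc hϖ
      hΔϖ hΨ hS1 hL1 hSΨ' hLΨ hKt₁0 hKx₁0 hKtΨ0 hKxΨ0 hT₂.le hη₁.le (Real.sqrt_nonneg _) hQz hnN hnK hnU
    exact absurd (hF2.trans hbound) (not_le.2 hzη)
  -- the union bound
  have hfin : μ {z | z ∈ (Φ N).good ∧ η < |dockDefect χ Ψ r τ σ N (Φ N) z|} ≤ ENNReal.ofReal δ := by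
    have hδ4 : 0 ≤ δ / 4 := by positivity
    calc μ {z | z ∈ (Φ N).good ∧ η < |dockDefect χ Ψ r τ σ N (Φ N) z|} ≤ μ (BadN ∪ BadK ∪ BadU ∪ BadE ∪ C0) :=
          measure_mono hsub
      _ ≤ μ (BadN ∪ BadK ∪ BadU ∪ BadE) + μ C0 := measure_union_le _ _
      _ ≤ μ (BadN ∪ BadK ∪ BadU) + μ BadE + μ C0 := by gcongr; exact measure_union_le _ _
      _ ≤ μ (BadN ∪ BadK) + μ BadU + μ BadE + μ C0 := by gcongr; exact measure_union_le _ _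
      _ ≤ μ BadN + μ BadK + μ BadU + μ BadE + μ C0 := by gcongr; exact measure_union_le _ _
      _ ≤ ENNReal.ofReal (δ / 4) + ENNReal.ofReal (δ / 4) + ENNReal.ofReal (δ / 4) + ENNReal.ofReal (δ / 4) + 0 := by
          gcongr
          exact m0.le
      _ = ENNReal.ofReal δ := by
          rw [add_zero, ← ENNReal.ofReal_add hδ4 hδ4, ← ENNReal.ofReal_add (by positivity) hδ4,
            ← ENNReal.ofReal_add (by positivity) hδ4]
          congr 1
          ring
  exact measure_contactDefect_le (Φ N) a₀ θ₀ u₀ χ Ψ r τ η (ENNReal.ofReal δ) hfin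

/-- **Registered stub S7 of skeleton v5, `stub_dockingR`: the kinetic docking from the `r`-ball residual.** Kinetic-cell chaos
under the evolved law (`KineticCellChaosLG`), no structure of the evolved one-body law between the kinetic cell and the `r`-ball
(`NoMesoscopicOscillationR`) and local uniform integrability of the kinetic collision counts (`LocalCountUI`) imply the route
target `ContactChaos`. [folklore] -/
theorem stub_dockingR : KineticCellChaosLG → NoMesoscopicOscillationR → LocalCountUI → Summit.AtomisticToContinuum.HydrodynamicLimit.Theses.InformationPercolationEngine.ContactChaos :=
  docking_of_aemeasurable_R @aemeasurable_unitAvg_badWeight @aemeasurable_unitAvg_rowCount_trunc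

end Summit.AtomisticToContinuum.HydrodynamicLimit.Theorems.EquilibriumForecastLine

end
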